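import Summits.ResolutionOfSingularities.ResolutionOfSingularities.Theorems.HilbertSamuelEliminationCampaignW42ConeHilbertSamuel
import Summits.ResolutionOfSingularities.ResolutionOfSingularities.Theorems.HilbertSamuelEliminationCampaignW42RidgeDimMonotoneOfThm3104
import Literature.RingTheory.HilbertSamuel.HilbertFunctionBaseChange
import Literature.RingTheory.HilbertSamuel.TangentConeChangeOfGenerators
import Literature.RingTheory.HilbertSamuel.RegularCriterion
import Literature.RingTheory.HilbertSamuel.DirectrixQuasiEtale
import HarnessLib

/-!
# [OURS · L1 W4.2] The ridge of a cone read at its rational points: `dim F(O_{C,0}) = dim F(C)` at the vertex, and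
# `O_{C,v} ≅ O_{C,0}` at every rational point `v` of the ridge (campaign s42, cell res-hironaka; informal crux
# `RidgeConfinement`, stmt-ResolutionOfSingularities-17845; `--supports`; brick B5 of the unconditional `RidgeDimMonotone`)

HONEST FRAMING. OURS (slot W4.2, prover res-L1-s42-pv-1, gen 5). `L` a field, `J ⊆ S = L[X_1, …, X_n]` a homogeneous
ideal, `C = Spec S/J` its cone.

* `map_shift_eq_of_mem_ridge`, `le_ker_eval_zero_of_mem_ridge`, **`nonempty_ringEquiv_localization_of_mem_ridge`** — for an
  `L`-rational point `v ∈ C(L)` lying in Giraud's ridge `F(C)(L)` the translation `τ_v` is an automorphism of `S/J` carrying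
  `𝔪_v` to `𝔪_0`, so the local rings `O_{C,v} = (S/J)_{𝔪_v}` and `O_{C,0} = (S/J)_{𝔪_0}` are isomorphic; hence
  `dim F(O_{C,v}) = dim F(O_{C,0})` (`localRidgeDim_localization_eq_of_mem_ridge`).
* **`tangentConeIdeal_vertex_eq_map`** — if `J` contains no linear forms, the images `x̄` of the variables are a minimal system of
  generators of the maximal ideal of `O_{C,0}` and the tangent cone ideal of `O_{C,0}` in these generators is `J` itself
  (extended along `L ≅ κ(O_{C,0})`): inclusion of forms plus equality of Hilbert functions (`H⁽⁰⁾(O_{C,0}) = H(S/J)`, g2's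
  `hilbertFun_localization_vertex_eq_hilbertFunQuot`);
* **`localRidgeDim_localization_vertex_eq_ridgeDim`** — `dim F(O_{C,0}) = dim F(C) := ridgeDim J` (both are the directrix
  dimension of `J · K̄[X]` at a perfect field `K̄`, Dietel (6.3.5)); `ridgeDim_map_eq` — `dim F` is invariant under extension
  of the base field.

These are the «vertex» and «translation» steps of Dietel's (8.2.6)/(8.2.7) in ridge form, used by the sequel
`…CampaignW42ConeRidgeDimPrime`. NOTHING here is a statement of H. Hironaka's manuscript [Hironaka2017]. AI review is weaker
than expert review. References (orientation only): J. Giraud, *Bull. Sci. Math.* 99 (1975) §1.5; B. Dietel, Dissertation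
Regensburg (2015), (6.3.5), (8.1.3), (8.2.6); V. Cossart, U. Jannsen, S. Saito, LNM 2270 (2020), §2.2, Rem. 18.29.
-/

noncomputable section

-- single-conjunct summit: the doubled namespace component `ResolutionOfSingularities` is mandated
set_option linter.dupNamespace false

open IsLocalRing MvPolynomial Module
open Literature.RingTheory.HilbertSamuel
open Literature.RingTheory.MvPolynomial (shift shift_X shift_shift shift_zero shift_injective eval_shift idealDegree
  mem_idealDegree finrank_homogeneousSubmodule_one)
open Literature.AlgebraicGeometry.Resolution

namespace Summit.ResolutionOfSingularities.ResolutionOfSingularities.Theorems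

namespace CampaignW42

universe u v

variable {L : Type u} [Field L] {n : ℕ} {J : Ideal (MvPolynomial (Fin n) L)} (hJ : IsHomogeneousIdeal J)

/-! ## Two homogeneous ideals, one inside the other, with the same Hilbert function are equal -/

/-- **The Hironaka–Grothendieck squeeze**: `J₁ ⊆ J₂` homogeneous (the larger one) with `H(S/J₁) = H(S/J₂)` forces `J₁ = J₂`.
[folklore] -/
theorem eq_of_le_of_hilbertFunQuot_eq {J₁ J₂ : Ideal (MvPolynomial (Fin n) L)} (hJ₂ : IsHomogeneousIdeal J₂) (hle : J₁ ≤ J₂)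
    (hH : ∀ d, hilbertFunQuot L n J₁ d = hilbertFunQuot L n J₂ d) : J₁ = J₂ := by
  classical
  haveI hfin : ∀ d, Module.Finite L (homogeneousSubmodule (Fin n) L d) := fun d =>
    Module.Finite.iff_fg.mpr (homogeneousSubmodule_fg (Fin n) L d)
  have hdeg : ∀ d, idealDegree J₁ d = idealDegree J₂ d := fun d => by
    have hsub : idealDegree J₁ d ≤ idealDegree J₂ d := fun f hf =>
      mem_idealDegree.mpr ⟨hle (mem_idealDegree.mp hf).1, (mem_idealDegree.mp hf).2⟩
    have h₂le : idealDegree J₂ d ≤ homogeneousSubmodule (Fin n) L d := inf_le_right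
    have h₁le : idealDegree J₁ d ≤ homogeneousSubmodule (Fin n) L d := inf_le_right
    haveI : Module.Finite L (idealDegree J₂ d) :=
      Module.Finite.of_injective (Submodule.inclusion h₂le) (Submodule.inclusion_injective h₂le)
    refine Submodule.eq_of_le_of_finrank_le hsub ?_
    have h1 := hH d
    unfold hilbertFunQuot at h1
    have h2 : finrank L (idealDegree J₂ d) ≤ finrank L (homogeneousSubmodule (Fin n) L d) := Submodule.finrank_mono h₂le
    have h3 : finrank L (idealDegree J₁ d) ≤ finrank L (homogeneousSubmodule (Fin n) L d) := Submodule.finrank_mono h₁le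
    have h4 : finrank L (idealDegree J₂ d) = finrank L (idealDegree J₁ d) := by omega
    exact h4.le
  refine le_antisymm hle fun f hf => ?_
  rw [← sum_homogeneousComponent f]
  refine Ideal.sum_mem _ fun d _ => ?_
  have hc : homogeneousComponent d f ∈ idealDegree J₂ d :=
    mem_idealDegree.mpr ⟨hJ₂ f hf d, homogeneousComponent_isHomogeneous d f⟩
  rw [← hdeg d] at hc
  exact (mem_idealDegree.mp hc).1

/-! ## Rational points of the ridge: the translation `τ_v` is an automorphism of `S/J` -/

section RidgePoint

variable {v : Fin n → L} (hv : v ∈ ridge L J)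

include hv in
/-- `τ_v J ⊆ J` for `v ∈ F(C)(L)`. [cite: Giraud1975, §1.5] -/
theorem map_shift_le_of_mem_ridge : J.map (shift v) ≤ J := by
  rw [Ideal.map_le_iff_le_comap]
  intro f hf
  have := mem_ridge_iff.mp hv f (by rw [coneIdeal_self]; exact hf)
  rwa [coneIdeal_self] at this

include hJ hv in
/-- **`τ_v J = J` for `v ∈ F(C)(L)`** (`τ_{-v} J ⊆ J` as well, the ridge being a group for homogeneous `J`).
[cite: Giraud1975, §1.5] -/
theorem map_shift_eq_of_mem_ridge : J.map (shift v) = J := by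
  refine le_antisymm (map_shift_le_of_mem_ridge hv) fun f hf => ?_
  have h1 : shift (-v) f ∈ J := map_shift_le_of_mem_ridge (neg_mem_ridge hJ hv) (Ideal.mem_map_of_mem _ hf)
  have h2 : f = shift v (shift (-v) f) := by rw [shift_shift, add_neg_cancel, shift_zero]
  rw [h2]
  exact Ideal.mem_map_of_mem _ h1

include hJ hv in
/-- A rational point of the ridge on which `J` vanishes forces `J ⊆ 𝔪_0` (`f(0) = (τ_{-v} f)(v) = 0`). [folklore] -/
theorem le_ker_eval_zero_of_mem_ridge (hJv : J ≤ RingHom.ker (eval v)) : J ≤ RingHom.ker (eval (0 : Fin n → L)) := by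
  intro f hf
  have h1 : shift (-v) f ∈ J := map_shift_le_of_mem_ridge (neg_mem_ridge hJ hv) (Ideal.mem_map_of_mem _ hf)
  have h2 := hJv h1
  rw [RingHom.mem_ker, eval_shift, add_neg_cancel] at h2
  exact h2

include hJ hv in
/-- The ideal of the point `v` on `S/J` is the pull-back of the ideal of the vertex along the automorphism `τ_v` of `S/J`.
[folklore] -/
theorem map_ker_eval_eq_comap_quotientEquiv (hJv : J ≤ RingHom.ker (eval v))
    (hJJ : J = J.map ((shiftEquiv v).toRingEquiv : MvPolynomial (Fin n) L →+* MvPolynomial (Fin n) L)) :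
    (RingHom.ker (eval v)).map (Ideal.Quotient.mk J) =
      ((RingHom.ker (eval (0 : Fin n → L))).map (Ideal.Quotient.mk J)).comap
        (Ideal.quotientEquiv J J (shiftEquiv v).toRingEquiv hJJ).toRingHom := by
  have hJ0 := le_ker_eval_zero_of_mem_ridge hJ hv hJv
  refine Ideal.comap_injective_of_surjective (Ideal.Quotient.mk J) Ideal.Quotient.mk_surjective ?_
  have hcomp : (Ideal.quotientEquiv J J (shiftEquiv v).toRingEquiv hJJ).toRingHom.comp (Ideal.Quotient.mk J) =
      (Ideal.Quotient.mk J).comp ((shiftEquiv v).toRingEquiv : MvPolynomial (Fin n) L →+* MvPolynomial (Fin n) L) := by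
    refine RingHom.ext fun f => ?_
    rfl
  rw [Ideal.comap_map_of_surjective _ Ideal.Quotient.mk_surjective, ← RingHom.ker_eq_comap_bot, Ideal.mk_ker,
    sup_eq_left.mpr hJv, Ideal.comap_comap, hcomp, ← Ideal.comap_comap,
    Ideal.comap_map_of_surjective _ Ideal.Quotient.mk_surjective, ← RingHom.ker_eq_comap_bot, Ideal.mk_ker,
    sup_eq_left.mpr hJ0, ← comap_shift_ker_eval_zero v]
  rfl

include hJ hv in
/-- **`O_{C,v} ≅ O_{C,0}` for an `L`-rational point `v ∈ C(L)` of the ridge `F(C)(L)`**: the translation `τ_v` induces an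
isomorphism of the local rings of the cone at `v` and at the vertex (for any localizations `Lv`, `L₀` of `S/J` at the two
maximal ideals). [cite: Giraud1975, §1.5] [cite: Dietel2015, (8.1.3)] -/
theorem nonempty_ringEquiv_localization_of_mem_ridge (hJv : J ≤ RingHom.ker (eval v))
    [((RingHom.ker (eval v)).map (Ideal.Quotient.mk J)).IsPrime]
    [((RingHom.ker (eval (0 : Fin n → L))).map (Ideal.Quotient.mk J)).IsPrime]
    (Lv : Type v) [CommRing Lv] [Algebra (MvPolynomial (Fin n) L ⧸ J) Lv]
    [IsLocalization.AtPrime Lv ((RingHom.ker (eval v)).map (Ideal.Quotient.mk J))]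
    (L₀ : Type v) [CommRing L₀] [Algebra (MvPolynomial (Fin n) L ⧸ J) L₀]
    [IsLocalization.AtPrime L₀ ((RingHom.ker (eval (0 : Fin n → L))).map (Ideal.Quotient.mk J))] :
    Nonempty (Lv ≃+* L₀) := by
  have hJJ : J = J.map ((shiftEquiv v).toRingEquiv : MvPolynomial (Fin n) L →+* MvPolynomial (Fin n) L) := by
    conv_lhs => rw [← map_shift_eq_of_mem_ridge hJ hv]
    rfl
  set e := Ideal.quotientEquiv J J (shiftEquiv v).toRingEquiv hJJ
  have hQ := map_ker_eval_eq_comap_quotientEquiv hJ hv hJv hJJ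
  have hM : Submonoid.map e.toMonoidHom ((RingHom.ker (eval v)).map (Ideal.Quotient.mk J)).primeCompl =
      ((RingHom.ker (eval (0 : Fin n → L))).map (Ideal.Quotient.mk J)).primeCompl := by
    ext x
    rw [Submonoid.mem_map]
    constructor
    · rintro ⟨y, hy, rfl⟩ hx
      refine hy ?_
      rw [hQ]
      exact hx
    · intro hx
      refine ⟨e.symm x, fun h' => hx ?_, e.apply_symm_apply x⟩
      have h'' : e.symm x ∈ (RingHom.ker (eval v)).map (Ideal.Quotient.mk J) := h'
      rw [hQ, Ideal.mem_comap] at h''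
      change e (e.symm x) ∈ _ at h''
      rw [e.apply_symm_apply] at h''
      exact h''
  exact ⟨IsLocalization.ringEquivOfRingEquiv Lv L₀ e hM⟩

end RidgePoint

/-! ## `dim F` of isomorphic local rings -/

omit hJ in
/-- `dim F(A) = dim F(B)` for isomorphic noetherian local rings (`dim F = ē`, CJS Rem. 18.29). [folklore] -/
theorem localRidgeDim_eq_of_ringEquiv {A B : Type v} [CommRing A] [CommRing B] [IsLocalRing A] [IsLocalRing B]
    [IsNoetherianRing A] [IsNoetherianRing B] (e : A ≃+* B) : localRidgeDim A = localRidgeDim B := by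
  have hA : localRidgeDim A = geomDirDim A := localRidgeDim_eq_dirDimOver_of_perfectField A _
  have hB : localRidgeDim B = geomDirDim B := localRidgeDim_eq_dirDimOver_of_perfectField B _
  rw [hA, hB]
  exact (geomDirDim_eq_of_ringEquiv e).symm

include hJ in
/-- **`dim F(O_{C,v}) = dim F(O_{C,0})` at a rational point of the ridge.** [cite: Dietel2015, (8.1.3)] -/
theorem localRidgeDim_localization_eq_of_mem_ridge {v : Fin n → L} (hv : v ∈ ridge L J) (hJv : J ≤ RingHom.ker (eval v))
    [((RingHom.ker (eval v)).map (Ideal.Quotient.mk J)).IsPrime]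
    [((RingHom.ker (eval (0 : Fin n → L))).map (Ideal.Quotient.mk J)).IsPrime]
    (Lv : Type v) [CommRing Lv] [Algebra (MvPolynomial (Fin n) L ⧸ J) Lv]
    [IsLocalization.AtPrime Lv ((RingHom.ker (eval v)).map (Ideal.Quotient.mk J))] [IsLocalRing Lv] [IsNoetherianRing Lv]
    (L₀ : Type v) [CommRing L₀] [Algebra (MvPolynomial (Fin n) L ⧸ J) L₀]
    [IsLocalization.AtPrime L₀ ((RingHom.ker (eval (0 : Fin n → L))).map (Ideal.Quotient.mk J))] [IsLocalRing L₀]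
    [IsNoetherianRing L₀] : localRidgeDim Lv = localRidgeDim L₀ := by
  obtain ⟨e⟩ := nonempty_ringEquiv_localization_of_mem_ridge hJ hv hJv Lv L₀
  exact localRidgeDim_eq_of_ringEquiv e

/-! ## The vertex: `x̄` is a minimal system of generators and the tangent cone ideal is `J` -/

section Vertex

variable [((RingHom.ker (eval (0 : Fin n → L))).map (Ideal.Quotient.mk J)).IsMaximal]
  (L₀ : Type u) [CommRing L₀] [Algebra (MvPolynomial (Fin n) L ⧸ J) L₀] [Algebra L L₀]
  [IsScalarTower L (MvPolynomial (Fin n) L ⧸ J) L₀]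
  [IsLocalization.AtPrime L₀ ((RingHom.ker (eval (0 : Fin n → L))).map (Ideal.Quotient.mk J))]
  [IsLocalRing L₀] [IsNoetherianRing L₀]

omit [((RingHom.ker (eval (0 : Fin n → L))).map (Ideal.Quotient.mk J)).IsMaximal]
  [IsLocalization.AtPrime L₀ ((RingHom.ker (eval (0 : Fin n → L))).map (Ideal.Quotient.mk J))] [IsLocalRing L₀]
  [IsNoetherianRing L₀] in
/-- The `L`-algebra map `S → L₀`, `X_i ↦ x̄_i`, is the structure map through `S/J`. [folklore] -/
theorem aeval_vertexPoint (g : MvPolynomial (Fin n) L) :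
    aeval (fun i : Fin n => algebraMap (MvPolynomial (Fin n) L ⧸ J) L₀ (Ideal.Quotient.mk J (X i))) g =
      algebraMap (MvPolynomial (Fin n) L ⧸ J) L₀ (Ideal.Quotient.mk J g) := by
  induction g using MvPolynomial.induction_on with
  | C c =>
    rw [aeval_C, IsScalarTower.algebraMap_apply L (MvPolynomial (Fin n) L ⧸ J) L₀,
      IsScalarTower.algebraMap_apply L (MvPolynomial (Fin n) L) (MvPolynomial (Fin n) L ⧸ J), Ideal.Quotient.algebraMap_eq,
      MvPolynomial.algebraMap_eq]
  | add p q hp hq => rw [map_add, hp, hq, map_add, map_add]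
  | mul_X p i hp => rw [map_mul, hp, aeval_X, map_mul, map_mul]

omit [IsNoetherianRing L₀] [Algebra L L₀] [IsScalarTower L (MvPolynomial (Fin n) L ⧸ J) L₀] in
/-- **`𝔪_{O_{C,0}} = (x̄_1, …, x̄_n)`**: the images of the variables generate the maximal ideal of the local ring at the
vertex. [folklore] -/
theorem span_range_vertexPoint_eq_maximalIdeal :
    Ideal.span (Set.range fun i : Fin n => algebraMap (MvPolynomial (Fin n) L ⧸ J) L₀ (Ideal.Quotient.mk J (X i))) =
      maximalIdeal L₀ := by
  rw [← IsLocalization.AtPrime.map_eq_maximalIdeal ((RingHom.ker (eval (0 : Fin n → L))).map (Ideal.Quotient.mk J)) L₀,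
    ker_eval_zero, Ideal.map_map, MvPolynomial.idealOfVars, Ideal.map_span, ← Set.range_comp]
  rfl

omit [IsNoetherianRing L₀] in
/-- The residue field of `L₀` as an `L`-algebra: `L → L₀ → κ(L₀)`. [folklore] -/
theorem residue_comp_algebraMap_vertex :
    (residue L₀).comp (algebraMap L L₀) = algebraMap L (ResidueField L₀) :=
  (IsScalarTower.algebraMap_eq L L₀ (ResidueField L₀)).symm

include hJ in
/-- **`emb.dim O_{C,0} = n` when `J` contains no linear forms** (`H⁽⁰⁾(O_{C,0})(1) = H(S/J)(1) = n − dim J_1`).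
[cite: CossartJannsenSaito2020, §2.2] -/
theorem spanFinrank_maximalIdeal_vertex_eq (hJ1 : finrank L (idealDegree J 1) = 0) : (maximalIdeal L₀).spanFinrank = n := by
  have h := congr_fun (hilbertFun_localization_vertex_eq_hilbertFunQuot hJ L₀) 1
  rw [hilbertFun_one_eq_spanFinrank, hilbertFunQuot, hJ1, finrank_homogeneousSubmodule_one] at h
  omega

include hJ in
/-- **The tangent cone of `O_{C,0}` is `C`**: in the (minimal, if `J_1 = 0`) generators `x̄` the tangent cone ideal of the
local ring of the cone at its vertex is `J · κ[X]`, `κ = κ(O_{C,0}) (= L)`. Proof: forms of `J` are relations (`⊇`); both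
ideals are homogeneous with Hilbert function `H(S/J)` (`H⁽⁰⁾(O_{C,0}) = H(S/J)`). [cite: CossartJannsenSaito2020, §2.2 (p. 27)]
[cite: Dietel2015, (8.1.3)] -/
theorem tangentConeIdeal_vertex_eq_map :
    tangentConeIdeal (fun i : Fin n => algebraMap (MvPolynomial (Fin n) L ⧸ J) L₀ (Ideal.Quotient.mk J (X i)))
        (span_range_vertexPoint_eq_maximalIdeal L₀) =
      J.map (MvPolynomial.map (algebraMap L (ResidueField L₀))) := by
  classical
  set xb : Fin n → L₀ := fun i => algebraMap (MvPolynomial (Fin n) L ⧸ J) L₀ (Ideal.Quotient.mk J (X i)) with hxb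
  have hxb_span := span_range_vertexPoint_eq_maximalIdeal (J := J) L₀
  set κ := algebraMap L (ResidueField L₀)
  -- (1) `⊇`: forms of `J` are relations among the `x̄`
  have hle : J.map (MvPolynomial.map κ) ≤ tangentConeIdeal xb hxb_span := by
    rw [Ideal.map_le_iff_le_comap]
    intro f hf
    rw [Ideal.mem_comap, ← sum_homogeneousComponent f, map_sum]
    refine Ideal.sum_mem _ fun d _ => ?_
    refine mem_tangentConeIdeal_of_mem_symbolForms xb hxb_span d ((mem_symbolForms_iff_exists_form xb hxb_span).mpr
      ⟨MvPolynomial.map (algebraMap L L₀) (homogeneousComponent d f), (homogeneousComponent_isHomogeneous d f).map _, ?_, ?_⟩)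
    · rw [eval_map, ← aeval_def, hxb, aeval_vertexPoint, Ideal.Quotient.eq_zero_iff_mem.mpr (hJ f hf d), map_zero]
      exact Ideal.zero_mem _
    · rw [MvPolynomial.map_map, residue_comp_algebraMap_vertex]
  -- (2) equal Hilbert functions
  have hH : ∀ d, hilbertFunQuot (ResidueField L₀) n (J.map (MvPolynomial.map κ)) d =
      hilbertFunQuot (ResidueField L₀) n (tangentConeIdeal xb hxb_span) d := fun d => by
    rw [hilbertFunQuot_map κ hJ, hilbertFunQuot_tangentConeIdeal xb hxb_span, hilbertFun_localization_vertex_eq_hilbertFunQuot hJ L₀]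
  exact (eq_of_le_of_hilbertFunQuot_eq (isHomogeneousIdeal_tangentConeIdeal xb hxb_span) hle hH).symm

include hJ in
/-- **`dim F(O_{C,0}) = dim F(C)`** for the local ring of a cone `C = V(J)` at its vertex, `J` homogeneous without linear forms:
both sides are the directrix dimension of `J · K̄[X]` for a perfect (here: algebraically closed) field `K̄ ⊇ L` (Dietel (6.3.5):
`dim F = e_{K̄}`; the tangent cone of `O_{C,0}` is `C`). [cite: Dietel2015, (6.3.5), (8.1.3)] [cite: CossartJannsenSaito2020, Rem. 18.29] -/
theorem localRidgeDim_localization_vertex_eq_ridgeDim (hJ1 : finrank L (idealDegree J 1) = 0) :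
    localRidgeDim L₀ = ridgeDim J := by
  classical
  let Kb := AlgebraicClosure (ResidueField L₀)
  letI : Algebra L Kb := ((algebraMap (ResidueField L₀) Kb).comp (algebraMap L (ResidueField L₀))).toAlgebra
  have he := spanFinrank_maximalIdeal_vertex_eq hJ L₀ hJ1
  obtain ⟨-, hr⟩ := radical_ridgeIdeal_coneIdeal_eq_and_ridgeDim_eq J hJ Kb
  rw [localRidgeDim_eq_dirDimOver_of_perfectField L₀ Kb,
    dirDimOver_eq' L₀ Kb he _ (span_range_vertexPoint_eq_maximalIdeal (J := J) L₀),
    tangentConeIdeal_vertex_eq_map hJ L₀, Ideal.map_map, hr, coneIdeal]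
  congr 2
  refine RingHom.ext fun p => ?_
  rw [RingHom.comp_apply, MvPolynomial.map_map]
  rfl

end Vertex

/-! ## `dim F` is invariant under extension of the base field -/

include hJ in
/-- **`dim F(C ×_L L') = dim F(C)`** for every field extension `ι : L → L'` (both are `e(J · K̄[X])` for an algebraically closed
`K̄ ⊇ L' ⊇ L`). [cite: Dietel2015, (6.3.5)] -/
theorem ridgeDim_map_eq {L' : Type u} [Field L'] (ι : L →+* L') : ridgeDim (J.map (MvPolynomial.map ι)) = ridgeDim J := by
  classical
  let Kb := AlgebraicClosure L'
  letI : Algebra L Kb := ((algebraMap L' Kb).comp ι).toAlgebra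
  obtain ⟨-, h1⟩ := radical_ridgeIdeal_coneIdeal_eq_and_ridgeDim_eq J hJ Kb
  obtain ⟨-, h2⟩ := radical_ridgeIdeal_coneIdeal_eq_and_ridgeDim_eq _ (isHomogeneousIdeal_map ι hJ) Kb
  rw [h2, h1, coneIdeal, coneIdeal, Ideal.map_map]
  congr 2
  refine RingHom.ext fun p => ?_
  rw [RingHom.comp_apply, MvPolynomial.map_map]
  rfl

include hJ in
/-- `J · L'[X]` has no linear forms if `J` has none. [cite: CossartJannsenSaito2020, Rem. 2.12 (a)] -/
theorem finrank_idealDegree_map_one_eq_zero {L' : Type u} [Field L'] (ι : L →+* L') (hJ1 : finrank L (idealDegree J 1) = 0) :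
    finrank L' (idealDegree (J.map (MvPolynomial.map ι)) 1) = 0 := by
  rw [finrank_idealDegree_map ι hJ, hJ1]

/-! ## Assembly: `dim F(O_{C,v}) = dim F(C)` at a rational point of the ridge -/

include hJ in
/-- **`dim F(O_{C,v}) = dim F(C)`** for an `L`-rational point `v ∈ C(L)` in the ridge of the cone `C = V(J)` of a homogeneous
ideal without linear forms, and any localization `Lv` of `S/J` at `𝔪_v`. [cite: Dietel2015, (8.1.3), (6.3.5)] -/
theorem localRidgeDim_localization_eq_ridgeDim_of_mem_ridge {v : Fin n → L} (hv : v ∈ ridge L J)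
    (hJv : J ≤ RingHom.ker (eval v)) (hJ1 : finrank L (idealDegree J 1) = 0)
    [((RingHom.ker (eval v)).map (Ideal.Quotient.mk J)).IsPrime]
    (Lv : Type u) [CommRing Lv] [Algebra (MvPolynomial (Fin n) L ⧸ J) Lv]
    [IsLocalization.AtPrime Lv ((RingHom.ker (eval v)).map (Ideal.Quotient.mk J))] [IsLocalRing Lv] [IsNoetherianRing Lv] :
    localRidgeDim Lv = ridgeDim J := by
  haveI := isMaximal_map_ker_eval (le_ker_eval_zero_of_mem_ridge hJ hv hJv)
  haveI : IsNoetherianRing (MvPolynomial (Fin n) L ⧸ J) := inferInstance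
  let L₀ := Localization.AtPrime ((RingHom.ker (eval (0 : Fin n → L))).map (Ideal.Quotient.mk J))
  rw [localRidgeDim_localization_eq_of_mem_ridge hJ hv hJv Lv L₀]
  exact localRidgeDim_localization_vertex_eq_ridgeDim hJ L₀ hJ1

end CampaignW42

end Summit.ResolutionOfSingularities.ResolutionOfSingularities.Theorems

end
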